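import Mathlib
import Summits.Ventures.PercRepro2.Defs
import Summits.Ventures.PercRepro2.Graph
import Summits.Ventures.PercRepro2.Events
import Summits.Ventures.PercRepro2.Harris
import Summits.Ventures.PercRepro2.XWForm

/-!
# The three-term identity of the cross W-form (PercRepro2, p2 g23)

With `a = {s ↔ u}`, `λ = {y ↔ o}`, `S = {s ↔ y}`, `Q = Sᶜ`, the law of total covariance on the
indicator of `S` writes `XW = Cov(a, λ) − P(S)²·Cov_S(a, λ)` as
`XW = P(Q)·[Cov_Q(a, λ) + P(S)·(Cov_S(a, λ) + Δa·Δλ)]`, `Δa = P(a|S) − P(a|Q)`,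
`Δλ = P(λ|S) − P(λ|Q)` — the identity of record behind every census line of P2-G23-XW.md
(`Cov_Q ≤ 0` is the cross-cluster term, the other two can have either sign).  Its division-free
form, with the unnormalised pieces

* `C_Q = P(Q)·P(Qaλ) − P(Qa)·P(Qλ)` (`= P(Q)²·Cov_Q(a, λ)`),
* `C_S = P(S)·P(Saλ) − P(Sa)·P(Sλ)` (`= P(S)²·Cov_S(a, λ)`),
* `D_a = P(Q)·P(Sa) − P(S)·P(Qa)` (`= P(Q)P(S)·Δa`), `D_λ = P(Q)·P(Sλ) − P(S)·P(Qλ)`,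

is **`P(Q)·P(S)·XW = P(S)·C_Q + P(Q)²·C_S + D_a·D_λ`** (`xwBil_three_term`): pure algebra from
`P(A ∩ S) + P(A ∩ Sᶜ) = P(A)` and `P(Sᶜ) = 1 − P(S)`.  In particular (XW) is trivial when
`Cov_S(a, λ) ≤ 0` (`xwBil_nonneg_of_covS_nonpos`: then `XW = Cov(a, λ) − C_S ≥ Cov(a, λ) ≥ 0`
by Harris), so (XW) has content only where `u ∈ C_s` and `o ∈ C_s` are positively correlated given
`s ↔ y`.  Own work; standard axioms.
-/

namespace Summit.Ventures.PercRepro2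

namespace XWThree

variable {V : Type*} {E : Type*} [Fintype E] [DecidableEq E]
  {R : Type*} [CommRing R] [LinearOrder R] [IsStrictOrderedRing R]

omit [LinearOrder R] [IsStrictOrderedRing R] in
/-- **The division-free three-term identity**
`P(Q)·P(S)·XW = P(S)·C_Q + P(Q)²·C_S + D_a·D_λ`. -/
theorem xwBil_three_term (ends : E → Sym2 V) (s y o u : V) (p : E → R) :
    prob p (connEvent ends s y)ᶜ * prob p (connEvent ends s y) * xwBil ends s y o u p p =
      prob p (connEvent ends s y) *
          (prob p (connEvent ends s y)ᶜ *
              prob p (connEvent ends s u ∩ connEvent ends y o ∩ (connEvent ends s y)ᶜ) -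
            prob p (connEvent ends s u ∩ (connEvent ends s y)ᶜ) *
              prob p (connEvent ends y o ∩ (connEvent ends s y)ᶜ)) +
        prob p (connEvent ends s y)ᶜ ^ 2 *
          (prob p (connEvent ends s y) *
              prob p (connEvent ends s y ∩ connEvent ends s u ∩ connEvent ends y o) -
            prob p (connEvent ends s y ∩ connEvent ends s u) *
              prob p (connEvent ends s y ∩ connEvent ends y o)) +
        (prob p (connEvent ends s y)ᶜ * prob p (connEvent ends s y ∩ connEvent ends s u) -
            prob p (connEvent ends s y) * prob p (connEvent ends s u ∩ (connEvent ends s y)ᶜ)) *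
          (prob p (connEvent ends s y)ᶜ * prob p (connEvent ends s y ∩ connEvent ends y o) -
            prob p (connEvent ends s y) * prob p (connEvent ends y o ∩ (connEvent ends s y)ᶜ)) := by
  unfold xwBil
  set S := connEvent ends s y with hS
  set a := connEvent ends s u with ha
  set l := connEvent ends y o with hl
  have h1 : prob p (a ∩ S) + prob p (a ∩ Sᶜ) = prob p a := prob_inter_add_prob_inter_compl p a S
  have h2 : prob p (l ∩ S) + prob p (l ∩ Sᶜ) = prob p l := prob_inter_add_prob_inter_compl p l S
  have h3 : prob p (a ∩ l ∩ S) + prob p (a ∩ l ∩ Sᶜ) = prob p (a ∩ l) :=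
    prob_inter_add_prob_inter_compl p (a ∩ l) S
  have hc : prob p Sᶜ = 1 - prob p S := prob_compl p S
  have e1 : S ∩ a = a ∩ S := Set.inter_comm _ _
  have e2 : S ∩ l = l ∩ S := Set.inter_comm _ _
  rw [e1, e2]
  have e3 : a ∩ S ∩ l = a ∩ l ∩ S := Set.inter_right_comm _ _ _
  rw [e3, hc, ← h1, ← h2, ← h3]
  ring

/-- **(XW) is trivial when `Cov_S(a, λ) ≤ 0`**: `XW = Cov(a, λ) − C_S ≥ Cov(a, λ) ≥ 0` (Harris), so
(XW) has content only where `u ∈ C_s` and `o ∈ C_s` are positively correlated given `s ↔ y`. -/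
theorem xwBil_nonneg_of_covS_nonpos (ends : E → Sym2 V) (s y o u : V) {p : E → R}
    (hp : IsProbVec p)
    (hS : prob p (connEvent ends s y) *
        prob p (connEvent ends s y ∩ connEvent ends s u ∩ connEvent ends y o) ≤
      prob p (connEvent ends s y ∩ connEvent ends s u) *
        prob p (connEvent ends s y ∩ connEvent ends y o)) :
    0 ≤ xwBil ends s y o u p p := by
  unfold xwBil
  have h := prob_mul_prob_le_prob_inter hp (isUpperSet_connEvent ends s u)
    (isUpperSet_connEvent ends y o)
  linarith

end XWThree

end Summit.Ventures.PercRepro2
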